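import Summits.CriticalPhenomena.CardyFormulaZ2.Theses.CardyBoundaryCoulombGas
import Summits.CriticalPhenomena.CardyFormulaZ2.Theorems.HalfPlaneOneArmThird.Negative.EventForms
import Literature.Probability.Percolation.QuadCrossingRotationUniformity
import Literature.Probability.Percolation.HalfPlaneOneArmBlockChain
import Literature.Probability.Percolation.HalfPlaneArmAxisInputs
import Literature.Probability.Percolation.HalfPlaneArmDiagonalInputs
import Literature.Probability.Percolation.HalfAnnulusQuad
import Literature.Probability.Percolation.ArmExponentOrientationTransfer

/-!
# `stub_rotationTransfer` (S5 of line `ip-passage-stirling`, crux `HalfPlaneOneArmThird`)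

Supporting file for item stmt-CriticalPhenomena-5662 (`CardyBoundaryCoulombGas.HalfPlaneOneArmThird`,
shared with `CardyTotalPositivity.HalfPlaneOneArmThird`): the ORIENTATION TRANSFER at exponent
level. Assuming the rotation invariance of quad-crossing probabilities of critical bond
percolation on `ℤ²` (Duminil-Copin–Kozlowski–Krachun–Manolescu–Oulamara, arXiv:2012.11672, Cor. 1.3
at `q = 1`, the tree's named fact `dkkmo_crossing_rotation_invariance`, the HYPOTHESIS of the
implication), the diagonal and the axis half-plane one-arm probabilities of bond-`ℤ²` at
`p = 1/2` have the same exponent: `(log π◇(n) - log π⁺(n)) / log n → 0`, where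
`π⁺(n) = P[0 ↔ {y₀ = ±n} ∪ {y₁ = n} in [-n,n]×[0,n]]` and
`π◇(n) = P[0 ↔ {s = -n} ∪ {d = ±n} in {s ≤ 1, s ≥ -n, |d| ≤ n}]`, `s = v₀ + v₁`, `d = v₀ - v₁`.

Proof (all percolation estimates are Literature theorems for abstract coordinates, instantiated
twice): for a modulus `L ≥ 8` let `Q_L` be the half-annulus quad `{0 ≤ im, 1 ≤ ‖·‖_∞ ≤ L}`
(`exists_halfAnnulusQuad`) and `e^{-iπ/4} Q_L` its rotation (`rotateQuad`). Along the scales `L^k`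
(axis, mesh `L^{-k}`) and `⌊√2 L^k⌋` (diagonal, same mesh, read on the diagonal lattice through
`v ↦ (v₀ - v₁, v₀ + v₁)`), each arm probability is quasi-multiplicative with the crossing
probabilities `P[𝒞_{L^{-k}}(Q_L)]`, resp. `P[𝒞_{L^{-k}}(e^{-iπ/4} Q_L)]`, as blocks, up to a factor
`C` per step INDEPENDENT of `L` (`HalfPlaneArm.arm_quadCrossing_chain`); the blocks are
`≥ c(L) > 0` (RSW) and, by the hypothesis (`.forall_angle`), differ by at most `c(L)/2` for `k`
large, hence by a factor `≤ 2`; `HalfPlaneArm.tendsto_log_sub_log_div_log` concludes.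
-/

noncomputable section

namespace Summit.CriticalPhenomena.CardyFormulaZ2.Cruxes.HalfPlaneOneArmThird.IpPassageStirling

open MeasureTheory Filter Topology Complex Set
open Literature.Probability.Percolation Literature.Probability.LatticeModels
open Literature.Probability.Percolation.TrackExchange Literature.Probability.RandomPlanarGeometry

/-! ## Geometric bookkeeping -/

/-- The rotation coefficient `e^{-iπ/4} = (√2/2)(1 - i)`. -/
theorem coe_circleExp_neg_pi_div_four :
    ((Circle.exp (-(Real.pi / 4)) : Circle) : ℂ) = ⟨Real.sqrt 2 / 2, -(Real.sqrt 2 / 2)⟩ := by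
  rw [Circle.coe_exp]
  apply Complex.ext
  · rw [Complex.exp_ofReal_mul_I_re, Real.cos_neg, Real.cos_pi_div_four]
  · rw [Complex.exp_ofReal_mul_I_im, Real.sin_neg, Real.sin_pi_div_four]

/-- `e^{-iπ/4}` has norm one. -/
theorem norm_cdiag : ‖(⟨Real.sqrt 2 / 2, -(Real.sqrt 2 / 2)⟩ : ℂ)‖ = 1 := by
  rw [← coe_circleExp_neg_pi_div_four]; exact Circle.norm_coe _

/-- `e^{-iπ/4} ≠ 0`. -/
theorem cdiag_ne_zero : (⟨Real.sqrt 2 / 2, -(Real.sqrt 2 / 2)⟩ : ℂ) ≠ 0 := by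
  rw [← coe_circleExp_neg_pi_div_four]; exact Circle.coe_ne_zero _

/-- The axis lattice at mesh `1/t` is drawn by `v ↦ 1 · (v₀ + i v₁) / t`. -/
theorem meshPoint_axis {t : ℝ} (ht : 0 < t) (v : Site 2) :
    meshPoint (1 / t) v = 1 * (((v 0 : ℤ) : ℂ) + ((v 1 : ℤ) : ℂ) * I) / (t : ℝ) := by
  apply Complex.ext
  · simp only [meshPoint_re, one_mul, div_ofReal_re, add_re, intCast_re, mul_re, I_re, mul_zero,
      intCast_im, I_im, mul_one, sub_self, add_zero]
    field_simp
  · simp only [meshPoint_im, one_mul, div_ofReal_im, add_im, intCast_im, mul_im, I_re, mul_zero,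
      intCast_re, I_im, mul_one, zero_add, add_zero]
    field_simp

/-- The same lattice at mesh `1/t` is drawn, in the diamond coordinates, by
`v ↦ e^{-iπ/4} (col v + i hgtOf v) / (√2 t)`. -/
theorem meshPoint_diag {t : ℝ} (ht : 0 < t) (v : Site 2) :
    meshPoint (1 / t) v = (⟨Real.sqrt 2 / 2, -(Real.sqrt 2 / 2)⟩ : ℂ) *
      (((col v : ℤ) : ℂ) + ((hgtOf v : ℤ) : ℂ) * I) / (Real.sqrt 2 * t : ℝ) := by
  have hs : Real.sqrt 2 * Real.sqrt 2 = 2 := Real.mul_self_sqrt (by norm_num)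
  have hs0 : 0 < Real.sqrt 2 := by positivity
  apply Complex.ext
  · simp only [meshPoint_re, div_ofReal_re, mul_re, add_re, intCast_re, mul_im, I_re, mul_zero, intCast_im,
      I_im, mul_one, sub_self, add_zero, add_im, zero_add, col, hgtOf, Int.cast_sub, Int.cast_add, sub_re, sub_im]
    field_simp
    nlinarith [hs]
  · simp only [meshPoint_im, div_ofReal_im, mul_im, add_re, intCast_re, mul_re, I_re, mul_zero, intCast_im,
      I_im, mul_one, sub_self, add_zero, add_im, zero_add, col, hgtOf, Int.cast_sub, Int.cast_add, sub_re, sub_im]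
    field_simp
    nlinarith [hs]

/-- Closures commute with a dilation-rotation `z ↦ c z`, `c ≠ 0`. -/
theorem closure_image_mul {c : ℂ} (hc : c ≠ 0) (S : Set ℂ) :
    closure ((fun w => c * w) '' S) = (fun w => c * w) '' closure S :=
  ((Homeomorph.mulLeft₀ c hc).image_closure S).symm

/-! ## The transfer -/

/-- **S5** `= RotationTransfer` verbatim (see the module docstring). -/
theorem stub_rotationTransfer :
    dkkmo_crossing_rotation_invariance →
      Tendsto (fun n : ℕ ↦
        (Real.log ((bondPercolation (zdGraph 2) half).real
            {ω | ∃ y : Site 2, (y 0 + y 1 = -(n : ℤ) ∨ y 0 - y 1 = (n : ℤ) ∨ y 0 - y 1 = -(n : ℤ)) ∧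
              ω ∈ openConnIn {v : Site 2 | v 0 + v 1 ≤ 1 ∧ -(n : ℤ) ≤ v 0 + v 1 ∧
                -(n : ℤ) ≤ v 0 - v 1 ∧ v 0 - v 1 ≤ n} 0 y}) -
          Real.log ((bondPercolation (zdGraph 2) half).real
            {ω | ∃ y : Site 2, (y 0 = (n : ℤ) ∨ y 0 = -(n : ℤ) ∨ y 1 = (n : ℤ)) ∧
              ω ∈ openConnIn {v : Site 2 | 0 ≤ v 1 ∧ -(n : ℤ) ≤ v 0 ∧ v 0 ≤ n ∧ v 1 ≤ n} 0 y})) /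
          Real.log n) atTop (𝓝 0) := by
  intro hDK
  set μ := bondPercolation (zdGraph 2) half with hμ
  -- the two sequences
  set π₁ : ℕ → ℝ := fun n => μ.real {ω | ∃ y : Site 2, (y 0 = (n : ℤ) ∨ y 0 = -(n : ℤ) ∨ y 1 = (n : ℤ)) ∧
    ω ∈ openConnIn {v : Site 2 | 0 ≤ v 1 ∧ -(n : ℤ) ≤ v 0 ∧ v 0 ≤ n ∧ v 1 ≤ n} 0 y} with hπ₁
  set π₂ : ℕ → ℝ := fun n => μ.real {ω | ∃ y : Site 2, (y 0 + y 1 = -(n : ℤ) ∨ y 0 - y 1 = (n : ℤ) ∨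
    y 0 - y 1 = -(n : ℤ)) ∧ ω ∈ openConnIn {v : Site 2 | v 0 + v 1 ≤ 1 ∧ -(n : ℤ) ≤ v 0 + v 1 ∧
      -(n : ℤ) ≤ v 0 - v 1 ∧ v 0 - v 1 ≤ n} 0 y} with hπ₂
  change Tendsto (fun n : ℕ => (Real.log (π₂ n) - Real.log (π₁ n)) / Real.log n) atTop (𝓝 0)
  -- as arm probabilities of the abstract layer
  have e₁ : ∀ n : ℕ, π₁ n = μ.real (openCrossing
      {v : Site 2 | 0 ≤ v 1 ∧ max |v 0 - (0 : Site 2) 0| (v 1 - (0 : Site 2) 1) ≤ (n : ℤ)} {0}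
      {v : Site 2 | max |v 0 - (0 : Site 2) 0| (v 1 - (0 : Site 2) 1) = (n : ℤ)}) := fun n => by
    simp only [hπ₁]; rw [HalfPlaneArm.axisArm_eq]
  have e₂ : ∀ n : ℕ, π₂ n = μ.real (openCrossing
      {v : Site 2 | 0 ≤ hgtOf v ∧ max |col v - col ![1, 0]| (hgtOf v - hgtOf ![1, 0]) ≤ (n : ℤ)} {![1, 0]}
      {v : Site 2 | max |col v - col ![1, 0]| (hgtOf v - hgtOf ![1, 0]) = (n : ℤ)}) := fun n =>
    HalfPlaneArm.real_diagArm_eq n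
  -- positivity and monotonicity
  have hpos₁ : ∀ n, 0 < π₁ n := fun n =>
    Summit.CriticalPhenomena.CardyFormulaZ2.Theorems.HalfPlaneOneArmThird.Negative.prob_pos (p := half)
      (by rw [coe_half]; norm_num) n
  have hpos₂ : ∀ n, 0 < π₂ n := fun n => HalfPlaneArm.real_diagArm_pos n
  have hanti₁ : ∀ m n : ℕ, m ≤ n → π₁ n ≤ π₁ m := fun m n hmn => by
    rw [e₁, e₁]
    exact HalfPlaneArm.real_arm_anti (X := fun v : Site 2 => v 0) (Y := fun v : Site 2 => v 1)
      HalfPlaneArm.axis_X_le HalfPlaneArm.axis_Y_le half 0 (by positivity) (by exact_mod_cast hmn)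
  have hanti₂ : ∀ m n : ℕ, m ≤ n → π₂ n ≤ π₂ m := fun m n hmn => by
    rw [e₂, e₂]
    exact HalfPlaneArm.real_arm_anti (X := col) (Y := hgtOf) HalfPlaneArm.diag_X_le HalfPlaneArm.diag_Y_le
      half ![1, 0] (by positivity) (by exact_mod_cast hmn)
  -- the chain constants of the two orientations (independent of the modulus `L`)
  have hs2 : (0 : ℝ) < Real.sqrt 2 := by positivity
  obtain ⟨C₁, hC₁, m₁, chain₁⟩ := HalfPlaneArm.arm_quadCrossing_chain (X := fun v : Site 2 => v 0)
    (Y := fun v : Site 2 => v 1) HalfPlaneArm.axis_X_le HalfPlaneArm.axis_Y_le HalfPlaneArm.axis_injective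
    (emb := squareLatticeEmbedding) isIsoradial_squareLatticeEmbedding_holds
    isRhombicTiling_squareLatticeEmbedding_holds (κ := Real.sqrt 2) hs2 HalfPlaneArm.axis_re HalfPlaneArm.axis_im
    HalfPlaneArm.axis_rswLR HalfPlaneArm.axis_rswTB (zdShiftIso ![0, 1]) (tX := 0) (by simp)
    (fun v => by simp) (fun v => by simp)
  obtain ⟨C₂, hC₂, m₂, chain₂⟩ := HalfPlaneArm.arm_quadCrossing_chain (X := col) (Y := hgtOf)
    HalfPlaneArm.diag_X_le HalfPlaneArm.diag_Y_le HalfPlaneArm.diag_injective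
    (emb := gmEmbedding (fun _ => (0 : ℝ)) (fun _ => Real.pi / 2)) isIsoradial_dia isRhombicTiling_dia (κ := 1)
    one_pos HalfPlaneArm.diag_re HalfPlaneArm.diag_im HalfPlaneArm.diag_rswLR HalfPlaneArm.diag_rswTB
    (zdShiftIso ![1, 0]) (tX := 1) (by simp) (fun v => by simp [col]; ring) (fun v => by simp [hgtOf]; ring)
  refine HalfPlaneArm.tendsto_log_sub_log_div_log hpos₁ hpos₂ hanti₁ hanti₂ (C := max C₁ C₂)
    (le_trans hC₁ (le_max_left _ _)) 8 fun L hL8 hL2 => ?_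
  -- fix a modulus `L ≥ 8`
  have hL1 : (1 : ℝ) < L := by exact_mod_cast (show 1 < L by omega)
  have hLpos : (0 : ℝ) < L := by positivity
  obtain ⟨R, hR0, hR1, hR2⟩ := HalfPlaneArm.exists_halfAnnulusQuad (L := (L : ℝ)) hL1
  set cd : ℂ := ⟨Real.sqrt 2 / 2, -(Real.sqrt 2 / 2)⟩ with hcd
  have hrot : (fun z : ℂ => rotation (Circle.exp (-(Real.pi / 4))) z) = fun z => cd * z := by
    funext z; rw [rotation_apply, coe_circleExp_neg_pi_div_four]
  set R' := rotateQuad (-(Real.pi / 4)) R with hR'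
  -- the two quads in the form consumed by the abstract layer
  have hcl₁ : closure R.carrier = (fun w => (1 : ℂ) * w) '' {z : ℂ | 0 ≤ z.im ∧ 1 ≤ max |z.re| |z.im| ∧
      max |z.re| |z.im| ≤ (L : ℝ)} := by rw [hR0]; simp only [one_mul, image_id']
  have h0₁ : R.arc 0 = (fun w => (1 : ℂ) * w) '' {z : ℂ | 0 ≤ z.im ∧ max |z.re| |z.im| = 1} := by
    rw [hR1]; simp only [one_mul, image_id']
  have h2₁ : R.arc 2 = (fun w => (1 : ℂ) * w) '' {z : ℂ | 0 ≤ z.im ∧ max |z.re| |z.im| = (L : ℝ)} := by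
    rw [hR2]; simp only [one_mul, image_id']
  have hcl₂ : closure R'.carrier = (fun w => cd * w) '' {z : ℂ | 0 ≤ z.im ∧ 1 ≤ max |z.re| |z.im| ∧
      max |z.re| |z.im| ≤ (L : ℝ)} := by
    rw [hR', carrier_rotateQuad, hrot, closure_image_mul cdiag_ne_zero, hR0]
  have h0₂ : R'.arc 0 = (fun w => cd * w) '' {z : ℂ | 0 ≤ z.im ∧ max |z.re| |z.im| = 1} := by
    rw [hR', arc_rotateQuad, hrot, hR1]
  have h2₂ : R'.arc 2 = (fun w => cd * w) '' {z : ℂ | 0 ≤ z.im ∧ max |z.re| |z.im| = (L : ℝ)} := by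
    rw [hR', arc_rotateQuad, hrot, hR2]
  -- lower bounds of the blocks and the rotation invariance
  obtain ⟨cq₁, hcq₁, mq₁, hq₁⟩ := HalfPlaneArm.quadCrossingProb_ge (X := fun v : Site 2 => v 0)
    (Y := fun v : Site 2 => v 1) HalfPlaneArm.axis_X_le HalfPlaneArm.axis_rswLR L hL2
  obtain ⟨cq₂, hcq₂, mq₂, hq₂⟩ := HalfPlaneArm.quadCrossingProb_ge (X := col) (Y := hgtOf)
    HalfPlaneArm.diag_X_le HalfPlaneArm.diag_rswLR L hL2
  set cq : ℝ := min cq₁ cq₂ with hcq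
  have hcq0 : 0 < cq := lt_min hcq₁ hcq₂
  obtain ⟨δ₀, hδ₀, hdk⟩ := hDK.forall_angle R (half_pos hcq0)
  -- the scales
  set N₂ : ℕ → ℕ := fun k => ⌊Real.sqrt 2 * (L : ℝ) ^ k⌋₊ with hN₂
  have hs1 : (1 : ℝ) ≤ Real.sqrt 2 := by
    rw [show (1 : ℝ) = Real.sqrt 1 by simp]; exact Real.sqrt_le_sqrt (by norm_num)
  have hs2' : Real.sqrt 2 < 2 := by
    rw [show (2 : ℝ) = Real.sqrt 4 by rw [show (4 : ℝ) = 2 ^ 2 by norm_num, Real.sqrt_sq (by norm_num)]]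
    exact Real.sqrt_lt_sqrt (by norm_num) (by norm_num)
  have hN₂lo : ∀ k, L ^ k ≤ N₂ k := fun k => by
    refine Nat.le_floor ?_
    push_cast
    nlinarith [pow_pos hLpos k]
  have hN₂hi : ∀ k, N₂ k ≤ 2 * L ^ k := fun k => by
    have : (N₂ k : ℝ) ≤ 2 * (L : ℝ) ^ k := (Nat.floor_le (by positivity)).trans (by nlinarith [pow_pos hLpos k])
    exact_mod_cast this
  have hN₂le : ∀ k, (N₂ k : ℝ) ≤ Real.sqrt 2 * (L : ℝ) ^ k := fun k => Nat.floor_le (by positivity)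
  have hN₂lt : ∀ k, Real.sqrt 2 * (L : ℝ) ^ k < N₂ k + 1 := fun k => Nat.lt_floor_add_one _
  -- the start index
  set k₀ : ℕ := m₁ + m₂ + mq₁ + mq₂ + ⌈1 / δ₀⌉₊ + 2 with hk₀
  have hpow : ∀ k, k₀ ≤ k → k₀ ≤ L ^ k ∧ 1 / (L : ℝ) ^ k < δ₀ := fun k hk => by
    have h1 : (k : ℝ) < (2 : ℝ) ^ k := by exact_mod_cast Nat.lt_two_pow_self
    have h2 : (2 : ℝ) ^ k ≤ (L : ℝ) ^ k := pow_le_pow_left₀ (by norm_num) (by exact_mod_cast hL2) k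
    have h3 : (1 / δ₀ : ℝ) ≤ ⌈1 / δ₀⌉₊ := Nat.le_ceil _
    have h4 : (⌈1 / δ₀⌉₊ : ℝ) ≤ k := by exact_mod_cast (show ⌈1 / δ₀⌉₊ ≤ k by omega)
    have h5 : (k₀ : ℝ) ≤ k := by exact_mod_cast hk
    refine ⟨?_, ?_⟩
    · have : (k₀ : ℝ) < ((L ^ k : ℕ) : ℝ) := by push_cast; linarith
      exact (Nat.cast_lt.1 this).le
    · rw [one_div_lt (by positivity) hδ₀]
      linarith
  -- arithmetic of the diagonal scales
  have hLN : ∀ k, L * N₂ k ≤ N₂ (k + 1) := fun k => by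
    have h := hN₂lt (k + 1); have h' := hN₂le k
    have : (L : ℝ) * N₂ k < N₂ (k + 1) + 1 := by rw [pow_succ] at h; nlinarith
    have : (L * N₂ k : ℕ) < N₂ (k + 1) + 1 := by exact_mod_cast this
    omega
  have hNL : ∀ k, N₂ (k + 1) ≤ L * N₂ k + L := fun k => by
    have h := hN₂le (k + 1); have h' := hN₂lt k
    have : ((N₂ (k + 1) : ℕ) : ℝ) < (L : ℝ) * N₂ k + L := by rw [pow_succ] at h; nlinarith
    have : (N₂ (k + 1) : ℕ) < L * N₂ k + L := by exact_mod_cast this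
    omega
  have hκ₁ : ∀ k, (L : ℝ) ^ k * (1 / (L : ℝ) ^ k) < 2 * ‖(1 : ℂ)‖ := fun k => by
    rw [norm_one, mul_one_div_cancel (by positivity)]; norm_num
  have hκ₂ : ∀ k, Real.sqrt 2 * (L : ℝ) ^ k * (1 / (L : ℝ) ^ k) < 2 * ‖cd‖ := fun k => by
    rw [hcd, norm_cdiag, mul_assoc, mul_one_div_cancel (by positivity)]; linarith [hs2']
  -- the blocks are bounded below
  have hqlo : ∀ k, k₀ ≤ k → cq₁ ≤ quadCrossingProb (1 / (L : ℝ) ^ k) R ∧ cq₂ ≤ quadCrossingProb (1 / (L : ℝ) ^ k) R' :=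
      fun k hk => by
    obtain ⟨hkL, -⟩ := hpow k hk
    constructor
    · exact hq₁ 0 rfl rfl R 1 (1 / (L : ℝ) ^ k) ((L : ℝ) ^ k) one_ne_zero (by positivity) (by positivity) hcl₁ h0₁ h2₁
        (meshPoint_axis (by positivity)) ((L ^ k : ℕ) : ℤ) ((L ^ (k + 1) : ℕ) : ℤ)
        (by exact_mod_cast (show mq₁ ≤ L ^ k by omega)) (by push_cast; rw [pow_succ]; nlinarith [pow_pos hLpos k])
        (by push_cast; rw [pow_succ]; nlinarith) (by push_cast; exact le_rfl) (by push_cast; rw [pow_succ]; nlinarith)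
    · exact hq₂ 0 (by simp [col]) (by simp [hgtOf]) R' cd (1 / (L : ℝ) ^ k) (Real.sqrt 2 * (L : ℝ) ^ k) cdiag_ne_zero
        (by positivity) (by positivity) hcl₂ h0₂ h2₂ (meshPoint_diag (by positivity)) (N₂ k : ℤ) (N₂ (k + 1) : ℤ)
        (by have := hN₂lo k; exact_mod_cast (show mq₂ ≤ N₂ k by omega)) (by exact_mod_cast hNL k)
        (by exact_mod_cast hLN k) (by exact_mod_cast hN₂le k)
        (by push_cast; have := hN₂lt (k + 1); rw [pow_succ] at this; linarith)
  refine ⟨fun k => L ^ k, N₂, fun k => quadCrossingProb (1 / (L : ℝ) ^ k) R,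
    fun k => quadCrossingProb (1 / (L : ℝ) ^ k) R', k₀, cq, hcq0, fun k hk => ⟨le_rfl, by show L ^ k ≤ 2 * L ^ k; omega, hN₂lo k, hN₂hi k⟩,
    fun k hk => ?_, fun k hk => ?_, fun k hk => ?_, fun k hk => ?_⟩
  · -- the blocks are bounded below (and by one)
    obtain ⟨b₁, b₂⟩ := hqlo k hk
    exact ⟨(min_le_left _ _).trans b₁, measureReal_le_one, (min_le_right _ _).trans b₂, measureReal_le_one⟩
  · -- the blocks agree up to a factor `2` (the rotation invariance)
    obtain ⟨b₁, b₂⟩ := hqlo k hk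
    obtain ⟨-, hδk⟩ := hpow k hk
    have hd := hdk (-(Real.pi / 4)) (1 / (L : ℝ) ^ k) ⟨by positivity, hδk⟩
    rw [abs_le] at hd
    have c₁ : cq ≤ quadCrossingProb (1 / (L : ℝ) ^ k) R := (min_le_left _ _).trans b₁
    have c₂ : cq ≤ quadCrossingProb (1 / (L : ℝ) ^ k) R' := (min_le_right _ _).trans b₂
    constructor <;> linarith
  · -- axis chain
    obtain ⟨hkL, -⟩ := hpow k hk
    have hc := chain₁ L hL8 0 0 le_rfl (show ((0 : Site 2) 1 : ℤ) ≤ 1 by simp) rfl rfl (by simp) (by simp) R 1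
      (1 / (L : ℝ) ^ k) ((L : ℝ) ^ k) one_ne_zero (by positivity) (by positivity) (hκ₁ k) hcl₁ h0₁ h2₁
      (meshPoint_axis (by positivity)) ((L ^ k : ℕ) : ℤ) ((L ^ (k + 1) : ℕ) : ℤ)
      (by exact_mod_cast (show m₁ ≤ L ^ k by omega)) (by push_cast; rw [pow_succ]; nlinarith)
      (by push_cast; rw [pow_succ]; nlinarith [pow_pos hLpos k]) (by push_cast; exact le_rfl) (by push_cast; linarith)
      (by push_cast; rw [pow_succ]; nlinarith) (by push_cast; rw [pow_succ]; nlinarith)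
    show π₁ (L ^ (k + 1)) ≤ max C₁ C₂ * π₁ (L ^ k) * quadCrossingProb (1 / (L : ℝ) ^ k) R ∧
      π₁ (L ^ k) * quadCrossingProb (1 / (L : ℝ) ^ k) R ≤ max C₁ C₂ * π₁ (L ^ (k + 1))
    rw [e₁, e₁]
    have n1 : 0 ≤ μ.real (openCrossing
      {v : Site 2 | 0 ≤ v 1 ∧ max |v 0 - (0 : Site 2) 0| (v 1 - (0 : Site 2) 1) ≤ ((L ^ k : ℕ) : ℤ)} {0}
      {v : Site 2 | max |v 0 - (0 : Site 2) 0| (v 1 - (0 : Site 2) 1) = ((L ^ k : ℕ) : ℤ)}) := measureReal_nonneg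
    have n2 : 0 ≤ μ.real (openCrossing
      {v : Site 2 | 0 ≤ v 1 ∧ max |v 0 - (0 : Site 2) 0| (v 1 - (0 : Site 2) 1) ≤ ((L ^ (k + 1) : ℕ) : ℤ)} {0}
      {v : Site 2 | max |v 0 - (0 : Site 2) 0| (v 1 - (0 : Site 2) 1) = ((L ^ (k + 1) : ℕ) : ℤ)}) := measureReal_nonneg
    have nq : 0 ≤ quadCrossingProb (1 / (L : ℝ) ^ k) R := measureReal_nonneg
    have hCC : C₁ ≤ max C₁ C₂ := le_max_left _ _
    exact ⟨hc.1.trans (by gcongr), hc.2.trans (by gcongr)⟩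
  · -- diagonal chain
    obtain ⟨hkL, -⟩ := hpow k hk
    have hc := chain₂ L hL8 ![1, 0] 0 (by simp [hgtOf]) (by simp [hgtOf]) (by simp [col]) (by simp [hgtOf])
      (by simp [col]) (by simp [hgtOf]) R' cd (1 / (L : ℝ) ^ k) (Real.sqrt 2 * (L : ℝ) ^ k) cdiag_ne_zero
      (by positivity) (by positivity) (hκ₂ k) hcl₂ h0₂ h2₂ (meshPoint_diag (by positivity)) (N₂ k : ℤ) (N₂ (k + 1) : ℤ)
      (by have := hN₂lo k; exact_mod_cast (show m₂ ≤ N₂ k by omega)) (by exact_mod_cast hLN k)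
      (by exact_mod_cast hNL k) (by exact_mod_cast hN₂le k) (by exact_mod_cast hN₂lt k)
      (by push_cast; have := hN₂le (k + 1); rw [pow_succ] at this; linarith)
      (by push_cast; have := hN₂lt (k + 1); rw [pow_succ] at this; linarith)
    show π₂ (N₂ (k + 1)) ≤ max C₁ C₂ * π₂ (N₂ k) * quadCrossingProb (1 / (L : ℝ) ^ k) R' ∧
      π₂ (N₂ k) * quadCrossingProb (1 / (L : ℝ) ^ k) R' ≤ max C₁ C₂ * π₂ (N₂ (k + 1))
    rw [e₂, e₂]
    have n1 : 0 ≤ μ.real (openCrossing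
      {v : Site 2 | 0 ≤ hgtOf v ∧ max |col v - col ![1, 0]| (hgtOf v - hgtOf ![1, 0]) ≤ ((N₂ k : ℕ) : ℤ)} {![1, 0]}
      {v : Site 2 | max |col v - col ![1, 0]| (hgtOf v - hgtOf ![1, 0]) = ((N₂ k : ℕ) : ℤ)}) := measureReal_nonneg
    have n2 : 0 ≤ μ.real (openCrossing
      {v : Site 2 | 0 ≤ hgtOf v ∧ max |col v - col ![1, 0]| (hgtOf v - hgtOf ![1, 0]) ≤ ((N₂ (k + 1) : ℕ) : ℤ)} {![1, 0]}
      {v : Site 2 | max |col v - col ![1, 0]| (hgtOf v - hgtOf ![1, 0]) = ((N₂ (k + 1) : ℕ) : ℤ)}) := measureReal_nonneg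
    have nq : 0 ≤ quadCrossingProb (1 / (L : ℝ) ^ k) R' := measureReal_nonneg
    have hCC : C₂ ≤ max C₁ C₂ := le_max_right _ _
    exact ⟨hc.1.trans (by gcongr), hc.2.trans (by gcongr)⟩

end Summit.CriticalPhenomena.CardyFormulaZ2.Cruxes.HalfPlaneOneArmThird.IpPassageStirling
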